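import Mathlib.Analysis.SpecialFunctions.Pow.Real
import Mathlib.Analysis.SpecialFunctions.Sqrt
import Mathlib.Algebra.BigOperators.Fin

/-!
# Type-I audit of the δ-direction commutator coefficients (pure real algebra)

Helper file for the line `log-lipschitz-budget` of the crux
`ImplosionDichotomy.PolynomialCompression` (stmt-AtomisticToContinuum-12587), stub
`stub_logBudgetShadowing` (level-3 estimate, top-order part).  Companion of
`shadow_commAudit_pointwise`: the coefficients of the one-step commutator `C_l` are first
derivatives of the σ-solution, `∂ₗu = ∂ₗu₁ + ∂ₗδu`, `∂ₗρ = ∂ₗρ₁ + ∂ₗδρ`, `∂ₗθ = ∂ₗθ₁ + ∂ₗδθ`; the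
reference parts are audited there, the δ-parts here, using the weak bootstrap bounds
`|∂ₗδu| ≤ C_b/λ`, `√θ₁ |∂ₗδρ|/ρ₁ ≤ C_b/λ`, `|∂ₗδθ|/√θ₁ ≤ C_b/λ` (`ρ₁ = c₁³`, `θ₁ = K c₁²`), which
are of Type-I size after weighting.  Proof: with `ε = C_b/λ` the δ-derivatives have sizes
`|∂ₗδu| ≤ ε`, `K (∂ₗδρ)² ≤ ε² c₁⁴`, `(∂ₗδθ)² ≤ ε² K c₁²`; each monomial of the pairing is absorbed
by a weighted Young inequality `κ x y ≤ L · ½ (P x² + Q y²)` (`κ² ≤ L² P Q`), the sizes of the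
coefficients being matched by the weights (`A ρ ≈ K c₁²`, `ρ B ≈ c₁⁴/K`); `Λ = 100 (K + 1) C_b`.
The private helpers are adapted from `ImplosionDichotomyPolynomialCompressionCommAudit`.
-/
namespace Summit.AtomisticToContinuum.HydrodynamicLimit.Theorems

open Finset

/-- AM–GM absorption of a cross term `κ x y` into `L · ½ (P x² + Q y²)` when `κ² ≤ L² P Q`.
[folklore] -/
private lemma commd_cross_le {P Q L κ x y : ℝ} (hP : 0 < P) (hL : 0 ≤ L)
    (hκ : κ ^ 2 ≤ L ^ 2 * P * Q) : κ * x * y ≤ L * (1 / 2 * (P * x ^ 2 + Q * y ^ 2)) := by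
  rcases hL.eq_or_lt with hL0 | hLpos
  · have hκ0 : κ = 0 := by rw [← hL0] at hκ; nlinarith [sq_nonneg κ]
    simp [hκ0, ← hL0]
  · have hy := mul_nonneg (sub_nonneg.2 hκ) (sq_nonneg y)
    nlinarith [sq_nonneg (L * P * x - κ * y), mul_pos hLpos hP]

/-- Transport-type term: `P x (d y) ≤ ε · ½ (P x² + P y²)` for `|d| ≤ ε`, `P ≥ 0`. [folklore] -/
private lemma commd_diag_le {P ε x y d : ℝ} (hP : 0 ≤ P) (hd : |d| ≤ ε) :
    P * x * (d * y) ≤ ε * (1 / 2 * (P * x ^ 2 + P * y ^ 2)) := by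
  obtain ⟨h1, h2⟩ := abs_le.1 hd
  have h : x * (d * y) ≤ ε * ((x ^ 2 + y ^ 2) / 2) := by
    nlinarith [mul_nonneg (sub_nonneg.2 h2) (sq_nonneg (x + y)),
      mul_nonneg (show (0 : ℝ) ≤ ε + d by linarith) (sq_nonneg (x - y))]
  calc P * x * (d * y) = P * (x * (d * y)) := by ring
    _ ≤ P * (ε * ((x ^ 2 + y ^ 2) / 2)) := mul_le_mul_of_nonneg_left h hP
    _ = ε * (1 / 2 * (P * x ^ 2 + P * y ^ 2)) := by ring

/-- A transport group `P x Σₘ (duₘ - du₁ₘ) yₘ` (`|duₘ - du₁ₘ| ≤ ε`) is `≤ 4 ε E` once `P x² ≤ 2E`,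
`P Σ yₘ² ≤ 2E`. [folklore] -/
private lemma commd_groupD_le {P ε E x : ℝ} {du du₁ y : Fin 3 → ℝ} (hP : 0 ≤ P) (hε : 0 ≤ ε)
    (hdu : ∀ m, |du m - du₁ m| ≤ ε) (hEx : P * x ^ 2 ≤ 2 * E)
    (hEy : P * (y 0 ^ 2 + y 1 ^ 2 + y 2 ^ 2) ≤ 2 * E) :
    P * x * ((du 0 - du₁ 0) * y 0 + (du 1 - du₁ 1) * y 1 + (du 2 - du₁ 2) * y 2) ≤
      4 * ε * E := by
  have h0 := commd_diag_le (x := x) (y := y 0) hP (hdu 0)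
  have h1 := commd_diag_le (x := x) (y := y 1) hP (hdu 1)
  have h2 := commd_diag_le (x := x) (y := y 2) hP (hdu 2)
  have h3 := mul_le_mul_of_nonneg_left hEx hε
  have h4 := mul_le_mul_of_nonneg_left hEy hε
  linarith

/-- The velocity transport group `P Σⱼ xⱼ Σₘ (duₘ - du₁ₘ) Yₘⱼ` (`|duₘ - du₁ₘ| ≤ ε`) is `≤ 4 ε E`
once `P Σ xⱼ² ≤ 2E` and `P Σ Yₘⱼ² ≤ 2E`. [folklore] -/
private lemma commd_groupU_le {P ε E : ℝ} {du du₁ x : Fin 3 → ℝ} {Y : Fin 3 → Fin 3 → ℝ}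
    (hP : 0 ≤ P) (hε : 0 ≤ ε) (hdu : ∀ m, |du m - du₁ m| ≤ ε)
    (hEx : P * (x 0 ^ 2 + x 1 ^ 2 + x 2 ^ 2) ≤ 2 * E)
    (hEy : P * (Y 0 0 ^ 2 + Y 0 1 ^ 2 + Y 0 2 ^ 2 + (Y 1 0 ^ 2 + Y 1 1 ^ 2 + Y 1 2 ^ 2) +
      (Y 2 0 ^ 2 + Y 2 1 ^ 2 + Y 2 2 ^ 2)) ≤ 2 * E) :
    P * (x 0 * ((du 0 - du₁ 0) * Y 0 0 + (du 1 - du₁ 1) * Y 1 0 + (du 2 - du₁ 2) * Y 2 0) +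
        x 1 * ((du 0 - du₁ 0) * Y 0 1 + (du 1 - du₁ 1) * Y 1 1 + (du 2 - du₁ 2) * Y 2 1) +
        x 2 * ((du 0 - du₁ 0) * Y 0 2 + (du 1 - du₁ 1) * Y 1 2 + (du 2 - du₁ 2) * Y 2 2)) ≤
      4 * ε * E := by
  have h00 := commd_diag_le (x := x 0) (y := Y 0 0) hP (hdu 0)
  have h10 := commd_diag_le (x := x 0) (y := Y 1 0) hP (hdu 1)
  have h20 := commd_diag_le (x := x 0) (y := Y 2 0) hP (hdu 2)
  have h01 := commd_diag_le (x := x 1) (y := Y 0 1) hP (hdu 0)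
  have h11 := commd_diag_le (x := x 1) (y := Y 1 1) hP (hdu 1)
  have h21 := commd_diag_le (x := x 1) (y := Y 2 1) hP (hdu 2)
  have h02 := commd_diag_le (x := x 2) (y := Y 0 2) hP (hdu 0)
  have h12 := commd_diag_le (x := x 2) (y := Y 1 2) hP (hdu 1)
  have h22 := commd_diag_le (x := x 2) (y := Y 2 2) hP (hdu 2)
  have h3 := mul_le_mul_of_nonneg_left hEx hε
  have h4 := mul_le_mul_of_nonneg_left hEy hε
  linarith

/-- A cross group `κ x Σₘ yₘ` is `≤ 4 L E` once `κ² ≤ L² P Q`, `P x² ≤ 2E`, `Q Σ yₘ² ≤ 2E`.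
[folklore] -/
private lemma commd_cross3_le {P Q L E κ x : ℝ} {y : Fin 3 → ℝ} (hP : 0 < P) (hL : 0 ≤ L)
    (hκ : κ ^ 2 ≤ L ^ 2 * P * Q) (hEx : P * x ^ 2 ≤ 2 * E)
    (hEy : Q * (y 0 ^ 2 + y 1 ^ 2 + y 2 ^ 2) ≤ 2 * E) :
    κ * x * (y 0 + y 1 + y 2) ≤ 4 * L * E := by
  have h0 := commd_cross_le (x := x) (y := y 0) hP hL hκ
  have h1 := commd_cross_le (x := x) (y := y 1) hP hL hκ
  have h2 := commd_cross_le (x := x) (y := y 2) hP hL hκ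
  have h3 := mul_le_mul_of_nonneg_left hEx hL
  have h4 := mul_le_mul_of_nonneg_left hEy hL
  linarith

/-- A diagonal cross group `Σⱼ κ xⱼ yⱼ` is `≤ 2 L E` once `κ² ≤ L² P Q`, `P Σ xⱼ² ≤ 2E`,
`Q Σ yⱼ² ≤ 2E`. [folklore] -/
private lemma commd_crossDiag3_le {P Q L E κ : ℝ} {x y : Fin 3 → ℝ} (hP : 0 < P) (hL : 0 ≤ L)
    (hκ : κ ^ 2 ≤ L ^ 2 * P * Q) (hEx : P * (x 0 ^ 2 + x 1 ^ 2 + x 2 ^ 2) ≤ 2 * E)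
    (hEy : Q * (y 0 ^ 2 + y 1 ^ 2 + y 2 ^ 2) ≤ 2 * E) :
    κ * x 0 * y 0 + κ * x 1 * y 1 + κ * x 2 * y 2 ≤ 2 * L * E := by
  have h0 := commd_cross_le (x := x 0) (y := y 0) hP hL hκ
  have h1 := commd_cross_le (x := x 1) (y := y 1) hP hL hκ
  have h2 := commd_cross_le (x := x 2) (y := y 2) hP hL hκ
  have h3 := mul_le_mul_of_nonneg_left hEx hL
  have h4 := mul_le_mul_of_nonneg_left hEy hL
  linarith

/-! ### Type-I sizes of the δ-coefficients -/

/-- The weak bootstrap bounds of `∂ₗδρ`, `∂ₗδθ`, squared: `K dR² ≤ ε² c₁⁴`, `dT² ≤ ε² K c₁²`.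
[folklore] -/
private lemma commd_delta_sq {K ε c₁ dR dT : ℝ} (hK : 0 < K) (hc₁ : 0 < c₁)
    (hdρ : Real.sqrt K * c₁ * |dR| / c₁ ^ 3 ≤ ε) (hdθ : |dT| / (Real.sqrt K * c₁) ≤ ε) :
    K * dR ^ 2 ≤ ε ^ 2 * c₁ ^ 4 ∧ dT ^ 2 ≤ ε ^ 2 * (K * c₁ ^ 2) := by
  have hsK : 0 < Real.sqrt K := Real.sqrt_pos.2 hK
  have hsq : Real.sqrt K ^ 2 = K := Real.sq_sqrt hK.le
  have h1 := pow_le_pow_left₀ (by positivity) ((div_le_iff₀ (by positivity)).1 hdρ) 2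
  have h2 := pow_le_pow_left₀ (abs_nonneg _) ((div_le_iff₀ (by positivity)).1 hdθ) 2
  refine ⟨le_of_mul_le_mul_right ?_ (pow_pos hc₁ 2), ?_⟩
  · calc K * dR ^ 2 * c₁ ^ 2 = Real.sqrt K ^ 2 * c₁ ^ 2 * |dR| ^ 2 := by rw [hsq, sq_abs]; ring
      _ = (Real.sqrt K * c₁ * |dR|) ^ 2 := by ring
      _ ≤ (ε * c₁ ^ 3) ^ 2 := h1
      _ = ε ^ 2 * c₁ ^ 4 * c₁ ^ 2 := by ring
  · calc dT ^ 2 = |dT| ^ 2 := (sq_abs dT).symm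
      _ ≤ (ε * (Real.sqrt K * c₁)) ^ 2 := h2
      _ = ε ^ 2 * (Real.sqrt K ^ 2 * c₁ ^ 2) := by ring
      _ = ε ^ 2 * (K * c₁ ^ 2) := by rw [hsq]

/-- Size of the `x_ρ · div Y_u` coefficient `A ∂ₗδρ`: `(A dR)² ≤ (3(K+1)ε)² A ρ`. [folklore] -/
private lemma commd_coeff_divu {K ε c₁ ρ A dR : ℝ} (hK : 0 < K) (hc₁ : 0 < c₁)
    (hρ : 0 < ρ) (hApos : 0 < A) (hAc : A * c₁ ≤ 15 * K / 4) (h2ρ : c₁ ^ 3 ≤ 2 * ρ)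
    (hR : K * dR ^ 2 ≤ ε ^ 2 * c₁ ^ 4) :
    (A * dR) ^ 2 ≤ (3 * (K + 1) * ε) ^ 2 * A * ρ := by
  refine le_of_mul_le_mul_right ?_ hK
  calc (A * dR) ^ 2 * K = A * A * (K * dR ^ 2) := by ring
    _ ≤ A * A * (ε ^ 2 * c₁ ^ 4) := by gcongr
    _ = A * (A * c₁) * c₁ ^ 3 * ε ^ 2 := by ring
    _ ≤ A * (15 * K / 4) * (2 * ρ) * ε ^ 2 := by gcongr
    _ ≤ (3 * (K + 1) * ε) ^ 2 * A * ρ * K := by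
        have : 0 ≤ ε ^ 2 * A * ρ * K * (9 * K ^ 2 + 18 * K + 3 / 2) := by positivity
        linarith

/-- Size of the `x_u · Y_ρ` coefficient `ρ ∂ₗ^δ A = γ ∂ₗδθ + (θ/ρ)(ργ' - γ) ∂ₗδρ`:
`κ² ≤ (12(K+1)ε)² ρ A`. [folklore] -/
private lemma commd_coeff_dA {K ε c₁ ρ A T γ μ dR dT κ : ℝ} (hK : 0 < K)
    (hc₁ : 0 < c₁) (hρ : 0 < ρ) (hApos : 0 < A) (hT : 0 < T) (hTc : T * c₁ ≤ 3 * K)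
    (h83 : K * c₁ ^ 2 ≤ 8 / 3 * (A * ρ)) (hγ2 : γ ^ 2 ≤ (5 / 4) ^ 2)
    (hμ2 : μ ^ 2 ≤ (13 / 8) ^ 2) (hR : K * dR ^ 2 ≤ ε ^ 2 * c₁ ^ 4)
    (hdT : dT ^ 2 ≤ ε ^ 2 * (K * c₁ ^ 2)) (hκ : κ = γ * dT + T * μ * dR) :
    κ ^ 2 ≤ (12 * (K + 1) * ε) ^ 2 * ρ * A := by
  have hTc2 : (T * c₁) ^ 2 ≤ (3 * K) ^ 2 := pow_le_pow_left₀ (by positivity) hTc 2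
  refine le_of_mul_le_mul_right ?_ hK
  calc κ ^ 2 * K = (γ * dT + T * μ * dR) ^ 2 * K := by rw [hκ]
    _ ≤ (2 * (γ * dT) ^ 2 + 2 * (T * μ * dR) ^ 2) * K :=
        mul_le_mul_of_nonneg_right (by nlinarith [sq_nonneg (γ * dT - T * μ * dR)]) hK.le
    _ = 2 * K * γ ^ 2 * dT ^ 2 + 2 * T ^ 2 * μ ^ 2 * (K * dR ^ 2) := by ring
    _ ≤ 2 * K * (5 / 4) ^ 2 * (ε ^ 2 * (K * c₁ ^ 2)) +
          2 * T ^ 2 * (13 / 8) ^ 2 * (ε ^ 2 * c₁ ^ 4) := by gcongr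
    _ = 25 / 8 * K * (K * c₁ ^ 2) * ε ^ 2 + 169 / 32 * (T * c₁) ^ 2 * c₁ ^ 2 * ε ^ 2 := by ring
    _ ≤ 25 / 8 * K * (K * c₁ ^ 2) * ε ^ 2 + 169 / 32 * (3 * K) ^ 2 * c₁ ^ 2 * ε ^ 2 := by gcongr
    _ = 1621 / 32 * K * (K * c₁ ^ 2) * ε ^ 2 := by ring
    _ ≤ 1621 / 32 * K * (8 / 3 * (A * ρ)) * ε ^ 2 := by gcongr
    _ ≤ (12 * (K + 1) * ε) ^ 2 * ρ * A * K := by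
        have : 0 ≤ ε ^ 2 * A * ρ * K * (144 * K ^ 2 + 288 * K + 107 / 12) := by positivity
        linarith

/-- Size of the `x_u · Y_θ` coefficient `ρ ζ' ∂ₗδρ = ζ1 ∂ₗδρ`: `κ² ≤ ((K+1)ε)² ρ B`. [folklore] -/
private lemma commd_coeff_dZ {K ε c₁ ρ B ζ1 dR κ : ℝ} (hK : 0 < K) (hc₁ : 0 < c₁)
    (hρ : 0 < ρ) (hBpos : 0 < B) (h2ρ : c₁ ^ 3 ≤ 2 * ρ) (hBK1 : ρ ≤ B * (K * c₁ ^ 2))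
    (hζ1 : ζ1 ^ 2 ≤ (1 / 8) ^ 2) (hR : K * dR ^ 2 ≤ ε ^ 2 * c₁ ^ 4) (hκ : κ = ζ1 * dR) :
    κ ^ 2 ≤ ((K + 1) * ε) ^ 2 * ρ * B := by
  have hKc : 0 < K * c₁ ^ 2 := by positivity
  have h6 : c₁ ^ 3 * c₁ ^ 3 ≤ (2 * ρ) * (2 * ρ) :=
    mul_le_mul h2ρ h2ρ (by positivity) (by positivity)
  refine le_of_mul_le_mul_right ?_ hKc
  calc κ ^ 2 * (K * c₁ ^ 2) = ζ1 ^ 2 * (K * dR ^ 2) * c₁ ^ 2 := by rw [hκ]; ring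
    _ ≤ (1 / 8) ^ 2 * (ε ^ 2 * c₁ ^ 4) * c₁ ^ 2 := by gcongr
    _ = 1 / 64 * ε ^ 2 * (c₁ ^ 3 * c₁ ^ 3) := by ring
    _ ≤ 1 / 64 * ε ^ 2 * ((2 * ρ) * (2 * ρ)) := by gcongr
    _ = 1 / 16 * ε ^ 2 * ρ * ρ := by ring
    _ ≤ 1 / 16 * ε ^ 2 * ρ * (B * (K * c₁ ^ 2)) := by gcongr
    _ ≤ ((K + 1) * ε) ^ 2 * ρ * B * (K * c₁ ^ 2) := by
        have : 0 ≤ ε ^ 2 * ρ * B * (K * c₁ ^ 2) * (K ^ 2 + 2 * K + 15 / 16) := by positivity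
        linarith

/-- Size of the `x_θ · div Y_u` coefficient `(2/3) B (ζ ∂ₗδθ + θ ζ' ∂ₗδρ)`:
`(B c_t)² ≤ (2(K+1)ε)² B ρ`. [folklore] -/
private lemma commd_coeff_dT {K ε c₁ ρ B T ζ0 ζ1 dR dT ct : ℝ} (hK : 0 < K)
    (hc₁ : 0 < c₁) (hρ : 0 < ρ) (hBpos : 0 < B) (hT : 0 < T) (hTc : T * c₁ ≤ 3 * K)
    (hBK2 : B * (K * c₁ ^ 2) ≤ 3 * ρ) (hζ0 : ζ0 ^ 2 ≤ (9 / 8) ^ 2) (hζ1 : ζ1 ^ 2 ≤ (1 / 8) ^ 2)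
    (hR : K * dR ^ 2 ≤ ε ^ 2 * c₁ ^ 4) (hdT : dT ^ 2 ≤ ε ^ 2 * (K * c₁ ^ 2))
    (hct : ct = 2 / 3 * (ζ0 * dT + T * ζ1 * dR)) :
    (B * ct) ^ 2 ≤ (2 * (K + 1) * ε) ^ 2 * B * ρ := by
  have hTc2 : (T * c₁) ^ 2 ≤ (3 * K) ^ 2 := pow_le_pow_left₀ (by positivity) hTc 2
  have hct2 : ct ^ 2 * K ≤ 5 / 4 * K * (K * c₁ ^ 2) * ε ^ 2 := by
    calc ct ^ 2 * K = 4 / 9 * (ζ0 * dT + T * ζ1 * dR) ^ 2 * K := by rw [hct]; ring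
      _ ≤ 4 / 9 * (2 * (ζ0 * dT) ^ 2 + 2 * (T * ζ1 * dR) ^ 2) * K :=
          mul_le_mul_of_nonneg_right (mul_le_mul_of_nonneg_left
            (by nlinarith [sq_nonneg (ζ0 * dT - T * ζ1 * dR)]) (by norm_num)) hK.le
      _ = 8 / 9 * K * ζ0 ^ 2 * dT ^ 2 + 8 / 9 * T ^ 2 * ζ1 ^ 2 * (K * dR ^ 2) := by ring
      _ ≤ 8 / 9 * K * (9 / 8) ^ 2 * (ε ^ 2 * (K * c₁ ^ 2)) +
            8 / 9 * T ^ 2 * (1 / 8) ^ 2 * (ε ^ 2 * c₁ ^ 4) := by gcongr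
      _ = 9 / 8 * K * (K * c₁ ^ 2) * ε ^ 2 + 1 / 72 * (T * c₁) ^ 2 * c₁ ^ 2 * ε ^ 2 := by ring
      _ ≤ 9 / 8 * K * (K * c₁ ^ 2) * ε ^ 2 + 1 / 72 * (3 * K) ^ 2 * c₁ ^ 2 * ε ^ 2 := by gcongr
      _ = 5 / 4 * K * (K * c₁ ^ 2) * ε ^ 2 := by ring
  refine le_of_mul_le_mul_right ?_ hK
  calc (B * ct) ^ 2 * K = B * (ct ^ 2 * K) * B := by ring
    _ ≤ B * (5 / 4 * K * (K * c₁ ^ 2) * ε ^ 2) * B := by gcongr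
    _ = 5 / 4 * K * ε ^ 2 * B * (B * (K * c₁ ^ 2)) := by ring
    _ ≤ 5 / 4 * K * ε ^ 2 * B * (3 * ρ) := by gcongr
    _ ≤ (2 * (K + 1) * ε) ^ 2 * B * ρ * K := by
        have : 0 ≤ ε ^ 2 * B * ρ * K * (4 * K ^ 2 + 8 * K + 1 / 4) := by positivity
        linarith

/-! ### The bootstrap window, the energy pieces, and the bound with the algebra done -/

/-- The bootstrap window: positivity and the comparison of the weights `A = θγ/ρ`, `B = 3ρ/(2θ)`
and the ratio `T = θ/ρ` with the reference scales. [folklore] -/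
private lemma commd_regime {K c₁ ρ θ ζ0 ζ1 A B T : ℝ} (hK : 0 < K) (hc₁ : 0 < c₁)
    (hζ0 : |ζ0 - 1| ≤ 1 / 8) (hζ1 : |ζ1| ≤ 1 / 8)
    (hρ : |ρ - c₁ ^ 3| ≤ c₁ ^ 3 / 2) (hθ : |θ - K * c₁ ^ 2| ≤ K * c₁ ^ 2 / 2)
    (hA : A = θ * (ζ0 + ζ1) / ρ) (hB : B = 3 / 2 * ρ / θ) (hT : T = θ / ρ) :
    0 < ρ ∧ 0 < A ∧ 0 < B ∧ 0 < T ∧ c₁ ^ 3 ≤ 2 * ρ ∧ T * c₁ ≤ 3 * K ∧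
      K * c₁ ^ 2 ≤ 8 / 3 * (A * ρ) ∧ A * c₁ ≤ 15 * K / 4 ∧
      ρ ≤ B * (K * c₁ ^ 2) ∧ B * (K * c₁ ^ 2) ≤ 3 * ρ := by
  obtain ⟨⟨hr1, hr2⟩, ht1, ht2⟩ := And.intro (abs_le.1 hρ) (abs_le.1 hθ)
  obtain ⟨⟨hz1, hz2⟩, hy1, hy2⟩ := And.intro (abs_le.1 hζ0) (abs_le.1 hζ1)
  obtain ⟨hc2, hc3⟩ : 0 < c₁ ^ 2 ∧ 0 < c₁ ^ 3 := ⟨by positivity, by positivity⟩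
  have hKc : 0 < K * c₁ ^ 2 := by positivity
  have hρlo : c₁ ^ 3 / 2 ≤ ρ := by linarith
  have hθlo : K * c₁ ^ 2 / 2 ≤ θ := by linarith
  have hθhi : θ ≤ 3 * (K * c₁ ^ 2) / 2 := by linarith
  have hρpos : 0 < ρ := by linarith
  have hθpos : 0 < θ := by linarith
  obtain ⟨hγlo, hγhi⟩ : 3 / 4 ≤ ζ0 + ζ1 ∧ ζ0 + ζ1 ≤ 5 / 4 := ⟨by linarith, by linarith⟩
  have hγpos : 0 < ζ0 + ζ1 := by linarith
  have hApos : 0 < A := by rw [hA]; positivity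
  have hBpos : 0 < B := by rw [hB]; positivity
  have hTpos : 0 < T := by rw [hT]; positivity
  have hAρ : A * ρ = θ * (ζ0 + ζ1) := by rw [hA]; field_simp
  have hBθ : B * θ = 3 / 2 * ρ := by rw [hB]; field_simp
  have hTρ : T * ρ = θ := by rw [hT]; field_simp
  have hTc : T * c₁ ≤ 3 * K := by
    refine le_of_mul_le_mul_right ?_ hρpos
    calc T * c₁ * ρ = θ * c₁ := by rw [← hTρ]; ring
      _ ≤ 3 * (K * c₁ ^ 2) / 2 * c₁ := by gcongr
      _ = 3 * K * (c₁ ^ 3 / 2) := by ring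
      _ ≤ 3 * K * ρ := by gcongr
  have hAρlo : 3 * (K * c₁ ^ 2) / 8 ≤ A * ρ := by
    rw [hAρ]; linarith [mul_le_mul hθlo hγlo (by norm_num) hθpos.le]
  have hAc : A * c₁ ≤ 15 * K / 4 := by
    have h0 := mul_le_mul hθhi hγhi hγpos.le (by positivity)
    have h1 : A * (c₁ ^ 3 / 2) ≤ A * ρ := mul_le_mul_of_nonneg_left hρlo hApos.le
    have h2 : A * c₁ * c₁ ^ 2 ≤ 15 * K / 4 * c₁ ^ 2 := by rw [hAρ] at h1; linarith
    exact le_of_mul_le_mul_right h2 hc2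
  have hBK1 : ρ ≤ B * (K * c₁ ^ 2) := by linarith [mul_le_mul_of_nonneg_left hθhi hBpos.le]
  have hBK2 : B * (K * c₁ ^ 2) ≤ 3 * ρ := by linarith [mul_le_mul_of_nonneg_left hθlo hBpos.le]
  exact ⟨hρpos, hApos, hBpos, hTpos, by linarith, hTc, by linarith, hAc, hBK1, hBK2⟩

/-- The pieces of the energy `E = ½|X|²_w + ½ Σₘ |Yₘ|²_w` are bounded by `2E`. [folklore] -/
private lemma commd_energy_pieces {A ρ B E xρ xθ : ℝ} {xu Yρ Yθ : Fin 3 → ℝ}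
    {Yu : Fin 3 → Fin 3 → ℝ} (hA : 0 < A) (hρ : 0 < ρ) (hB : 0 < B)
    (hE : E = 1 / 2 * (A * xρ ^ 2 + ρ * (xu 0 ^ 2 + xu 1 ^ 2 + xu 2 ^ 2) + B * xθ ^ 2) +
      1 / 2 * (A * Yρ 0 ^ 2 + ρ * (Yu 0 0 ^ 2 + Yu 0 1 ^ 2 + Yu 0 2 ^ 2) + B * Yθ 0 ^ 2 +
        (A * Yρ 1 ^ 2 + ρ * (Yu 1 0 ^ 2 + Yu 1 1 ^ 2 + Yu 1 2 ^ 2) + B * Yθ 1 ^ 2) +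
        (A * Yρ 2 ^ 2 + ρ * (Yu 2 0 ^ 2 + Yu 2 1 ^ 2 + Yu 2 2 ^ 2) + B * Yθ 2 ^ 2))) :
    0 ≤ E ∧ A * xρ ^ 2 ≤ 2 * E ∧ ρ * (xu 0 ^ 2 + xu 1 ^ 2 + xu 2 ^ 2) ≤ 2 * E ∧
      B * xθ ^ 2 ≤ 2 * E ∧ A * (Yρ 0 ^ 2 + Yρ 1 ^ 2 + Yρ 2 ^ 2) ≤ 2 * E ∧
      ρ * (Yu 0 0 ^ 2 + Yu 0 1 ^ 2 + Yu 0 2 ^ 2 + (Yu 1 0 ^ 2 + Yu 1 1 ^ 2 + Yu 1 2 ^ 2) +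
        (Yu 2 0 ^ 2 + Yu 2 1 ^ 2 + Yu 2 2 ^ 2)) ≤ 2 * E ∧
      ρ * (Yu 0 0 ^ 2 + Yu 1 1 ^ 2 + Yu 2 2 ^ 2) ≤ 2 * E ∧
      B * (Yθ 0 ^ 2 + Yθ 1 ^ 2 + Yθ 2 ^ 2) ≤ 2 * E := by
  have n1 : 0 ≤ A * xρ ^ 2 := by positivity
  have n2 : 0 ≤ ρ * (xu 0 ^ 2 + xu 1 ^ 2 + xu 2 ^ 2) := by positivity
  have n3 : 0 ≤ B * xθ ^ 2 := by positivity
  have n4 : 0 ≤ A * (Yρ 0 ^ 2 + Yρ 1 ^ 2 + Yρ 2 ^ 2) := by positivity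
  have n5 : 0 ≤ ρ * (Yu 0 0 ^ 2 + Yu 1 1 ^ 2 + Yu 2 2 ^ 2) := by positivity
  have n6 : 0 ≤ ρ * (Yu 0 1 ^ 2 + Yu 0 2 ^ 2 + Yu 1 0 ^ 2 + Yu 1 2 ^ 2 + Yu 2 0 ^ 2 +
      Yu 2 1 ^ 2) := by positivity
  have n7 : 0 ≤ B * (Yθ 0 ^ 2 + Yθ 1 ^ 2 + Yθ 2 ^ 2) := by positivity
  have h2E : 2 * E = A * xρ ^ 2 + ρ * (xu 0 ^ 2 + xu 1 ^ 2 + xu 2 ^ 2) + B * xθ ^ 2 +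
      A * (Yρ 0 ^ 2 + Yρ 1 ^ 2 + Yρ 2 ^ 2) + ρ * (Yu 0 0 ^ 2 + Yu 1 1 ^ 2 + Yu 2 2 ^ 2) +
      ρ * (Yu 0 1 ^ 2 + Yu 0 2 ^ 2 + Yu 1 0 ^ 2 + Yu 1 2 ^ 2 + Yu 2 0 ^ 2 + Yu 2 1 ^ 2) +
      B * (Yθ 0 ^ 2 + Yθ 1 ^ 2 + Yθ 2 ^ 2) := by
    rw [hE]; ring
  refine ⟨?_, ?_, ?_, ?_, ?_, ?_, ?_, ?_⟩ <;> linarith only [h2E, n1, n2, n3, n4, n5, n6, n7]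

/-- The δ-coefficient commutator pairing estimate in terms of the weights `A = θ(ζ0+ζ1)/ρ`,
`B = 3ρ/(2θ)`, the δ-derivatives `du - du₁`, `dR = ∂ₗδρ`, `dT = ∂ₗδθ` (sizes `ε`, `K dR² ≤ ε² c₁⁴`,
`dT² ≤ ε² K c₁²`), the coefficients `c_a, c_z, c_t` and the total energy `E`. [folklore] -/
private theorem commd_main_bound (K ε c₁ ρ θ ζ0 ζ1 ζ2 dR dT xρ xθ A B E ca cz ct : ℝ)
    (du du₁ xu Yρ Yθ : Fin 3 → ℝ) (Yu : Fin 3 → Fin 3 → ℝ)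
    (hK : 0 < K) (hε : 0 ≤ ε) (hc₁ : 0 < c₁)
    (hζ0 : |ζ0 - 1| ≤ 1 / 8) (hζ1 : |ζ1| ≤ 1 / 8) (hζ2 : |ζ2| ≤ 1 / 8)
    (hρ : |ρ - c₁ ^ 3| ≤ c₁ ^ 3 / 2) (hθ : |θ - K * c₁ ^ 2| ≤ K * c₁ ^ 2 / 2)
    (hdu : ∀ m, |du m - du₁ m| ≤ ε) (hR : K * dR ^ 2 ≤ ε ^ 2 * c₁ ^ 4)
    (hdT : dT ^ 2 ≤ ε ^ 2 * (K * c₁ ^ 2))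
    (hA : A = θ * (ζ0 + ζ1) / ρ) (hB : B = 3 / 2 * ρ / θ)
    (hca : ca = (ζ0 + ζ1) / ρ * dT + θ * (2 * ζ1 + ζ2 - (ζ0 + ζ1)) / ρ ^ 2 * dR)
    (hcz : cz = ζ1 / ρ * dR) (hct : ct = 2 / 3 * (ζ0 * dT + θ * (ζ1 / ρ) * dR))
    (hE : E = 1 / 2 * (A * xρ ^ 2 + ρ * (xu 0 ^ 2 + xu 1 ^ 2 + xu 2 ^ 2) + B * xθ ^ 2) +
      1 / 2 * (A * Yρ 0 ^ 2 + ρ * (Yu 0 0 ^ 2 + Yu 0 1 ^ 2 + Yu 0 2 ^ 2) + B * Yθ 0 ^ 2 +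
        (A * Yρ 1 ^ 2 + ρ * (Yu 1 0 ^ 2 + Yu 1 1 ^ 2 + Yu 1 2 ^ 2) + B * Yθ 1 ^ 2) +
        (A * Yρ 2 ^ 2 + ρ * (Yu 2 0 ^ 2 + Yu 2 1 ^ 2 + Yu 2 2 ^ 2) + B * Yθ 2 ^ 2))) :
    A * xρ * ((du 0 - du₁ 0) * Yρ 0 + (du 1 - du₁ 1) * Yρ 1 + (du 2 - du₁ 2) * Yρ 2 +
        dR * (Yu 0 0 + Yu 1 1 + Yu 2 2)) +
      ρ * (xu 0 * ((du 0 - du₁ 0) * Yu 0 0 + (du 1 - du₁ 1) * Yu 1 0 + (du 2 - du₁ 2) * Yu 2 0 +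
            ca * Yρ 0 + cz * Yθ 0) +
          xu 1 * ((du 0 - du₁ 0) * Yu 0 1 + (du 1 - du₁ 1) * Yu 1 1 + (du 2 - du₁ 2) * Yu 2 1 +
            ca * Yρ 1 + cz * Yθ 1) +
          xu 2 * ((du 0 - du₁ 0) * Yu 0 2 + (du 1 - du₁ 1) * Yu 1 2 + (du 2 - du₁ 2) * Yu 2 2 +
            ca * Yρ 2 + cz * Yθ 2)) +
      B * xθ * ((du 0 - du₁ 0) * Yθ 0 + (du 1 - du₁ 1) * Yθ 1 + (du 2 - du₁ 2) * Yθ 2 +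
        ct * (Yu 0 0 + Yu 1 1 + Yu 2 2))
      ≤ 100 * (K + 1) * ε * E := by
  -- the ratio `T = θ / ρ`, the bootstrap window, and the squares of the small quantities
  obtain ⟨T, hT⟩ : ∃ T : ℝ, T = θ / ρ := ⟨_, rfl⟩
  obtain ⟨hρpos, hApos, hBpos, hTpos, h2ρ, hTc, h83, hAc, hBK1, hBK2⟩ :=
    commd_regime hK hc₁ hζ0 hζ1 hρ hθ hA hB hT
  obtain ⟨⟨hz1, hz2⟩, hy1, hy2⟩ := And.intro (abs_le.1 hζ0) (abs_le.1 hζ1)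
  obtain ⟨hw1, hw2⟩ := abs_le.1 hζ2
  have hγ2 : (ζ0 + ζ1) ^ 2 ≤ (5 / 4) ^ 2 := sq_le_sq' (by linarith) (by linarith)
  have hμ2 : (2 * ζ1 + ζ2 - (ζ0 + ζ1)) ^ 2 ≤ (13 / 8) ^ 2 := sq_le_sq' (by linarith) (by linarith)
  have hζ0sq : ζ0 ^ 2 ≤ (9 / 8) ^ 2 := sq_le_sq' (by linarith) (by linarith)
  have hζ1sq : ζ1 ^ 2 ≤ (1 / 8) ^ 2 := sq_le_sq' (by linarith) hy2
  -- the coefficients, cleared of denominators, and their sizes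
  have hι : ρ * ρ⁻¹ = 1 := mul_inv_cancel₀ hρpos.ne'
  have hca' : ρ * ca = (ζ0 + ζ1) * dT + T * (2 * ζ1 + ζ2 - (ζ0 + ζ1)) * dR := by
    rw [hca, hT]
    linear_combination ((ζ0 + ζ1) * dT + θ * ρ⁻¹ * (2 * ζ1 + ζ2 - (ζ0 + ζ1)) * dR) * hι
  have hcz' : ρ * cz = ζ1 * dR := by rw [hcz]; linear_combination (ζ1 * dR) * hι
  have hct' : ct = 2 / 3 * (ζ0 * dT + T * ζ1 * dR) := by rw [hct, hT]; ring
  have hκ2 := commd_coeff_divu hK hc₁ hρpos hApos hAc h2ρ hR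
  have hκ4 := commd_coeff_dA hK hc₁ hρpos hApos hTpos hTc h83 hγ2 hμ2 hR hdT hca'
  have hκ5 := commd_coeff_dZ hK hc₁ hρpos hBpos h2ρ hBK1 hζ1sq hR hcz'
  have hκ7 := commd_coeff_dT hK hc₁ hρpos hBpos hTpos hTc hBK2 hζ0sq hζ1sq hR hdT hct'
  -- the pieces of the energy and the seven groups of monomials
  obtain ⟨hE0, F1, Fxu, F3, F4, FYu, F6, F7⟩ := commd_energy_pieces hApos hρpos hBpos hE
  have G1 := commd_groupD_le (x := xρ) (y := Yρ) hApos.le hε hdu F1 F4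
  have G2 : A * dR * xρ * (Yu 0 0 + Yu 1 1 + Yu 2 2) ≤ 4 * (3 * (K + 1) * ε) * E :=
    commd_cross3_le (x := xρ) (y := fun m => Yu m m) hApos (by positivity) hκ2 F1 F6
  have G3 := commd_groupU_le (x := xu) (Y := Yu) hρpos.le hε hdu Fxu FYu
  have G4 := commd_crossDiag3_le (x := xu) (y := Yρ) hρpos (by positivity) hκ4 Fxu F4
  have G5 := commd_crossDiag3_le (x := xu) (y := Yθ) hρpos (by positivity) hκ5 Fxu F7
  have G6 := commd_groupD_le (x := xθ) (y := Yθ) hBpos.le hε hdu F3 F7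
  have G7 : B * ct * xθ * (Yu 0 0 + Yu 1 1 + Yu 2 2) ≤ 4 * (2 * (K + 1) * ε) * E :=
    commd_cross3_le (x := xθ) (y := fun m => Yu m m) hBpos (by positivity) hκ7 F3 F6
  have hslack : 0 ≤ (54 * K + 42) * ε * E := by positivity
  linear_combination G1 + G2 + G3 + G4 + G5 + G6 + G7 + hslack

/-- **Type-I bound of the δ-direction commutator pairing, generic jets.** Given `K > 0`, `Cb, cZ ≥ 0`
there is `Λ ≥ 0` such that at every point of the bootstrap regime, for arbitrary jets `x, Y`, direction `l`
and gradient numbers `du l m, dρ l, dθ l` of the σ-solution with `|du l m - du₁ l m| ≤ Cb/λ`,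
`√K c₁ |dρ l - 3c₁²dc₁ l|/c₁³ ≤ Cb/λ`, `|dθ l - 2Kc₁ dc₁ l|/(√K c₁) ≤ Cb/λ`, the pairing with the
δ-parts of the coefficients is `≤ (Λ/λ)(½|X|²_w + ½ Σₘ |Yₘ|²_w)`. [folklore] -/
theorem shadow_commAuditDelta_pointwise :
    ∀ (K Cb cZ : ℝ), 0 < K → 0 ≤ Cb → 0 ≤ cZ →
      ∃ Λ : ℝ, 0 ≤ Λ ∧
        ∀ (lam c₁ ρ θ ζ0 ζ1 ζ2 ηh : ℝ) (du du₁ : Fin 3 → Fin 3 → ℝ) (dc₁ dρ dθ : Fin 3 → ℝ)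
          (xρ xθ : ℝ) (xu : Fin 3 → ℝ) (Yρ Yθ : Fin 3 → ℝ) (Yu : Fin 3 → Fin 3 → ℝ) (l : Fin 3),
          0 < lam → 0 < c₁ → 0 ≤ ηh → ηh * (cZ + 1) ≤ 1 / 8 →
          |ζ0 - 1| ≤ cZ * ηh → |ζ1| ≤ cZ * ηh → |ζ2| ≤ cZ * ηh →
          |ρ - c₁ ^ 3| ≤ c₁ ^ 3 / 2 → |θ - K * c₁ ^ 2| ≤ K * c₁ ^ 2 / 2 →
          (∀ m, |du l m - du₁ l m| ≤ Cb / lam) →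
          Real.sqrt K * c₁ * |dρ l - 3 * c₁ ^ 2 * dc₁ l| / c₁ ^ 3 ≤ Cb / lam →
          |dθ l - 2 * K * c₁ * dc₁ l| / (Real.sqrt K * c₁) ≤ Cb / lam →
          θ * (ζ0 + ζ1) / ρ * xρ *
              (∑ m, (du l m - du₁ l m) * Yρ m + (dρ l - 3 * c₁ ^ 2 * dc₁ l) * ∑ m, Yu m m) +
            ρ * ∑ j, xu j *
              (∑ m, (du l m - du₁ l m) * Yu m j +
                ((ζ0 + ζ1) / ρ * (dθ l - 2 * K * c₁ * dc₁ l) +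
                    θ * (2 * ζ1 + ζ2 - (ζ0 + ζ1)) / ρ ^ 2 * (dρ l - 3 * c₁ ^ 2 * dc₁ l)) * Yρ j +
                ζ1 / ρ * (dρ l - 3 * c₁ ^ 2 * dc₁ l) * Yθ j) +
            3 / 2 * ρ / θ * xθ *
              (∑ m, (du l m - du₁ l m) * Yθ m +
                2 / 3 * (ζ0 * (dθ l - 2 * K * c₁ * dc₁ l) + θ * (ζ1 / ρ) * (dρ l - 3 * c₁ ^ 2 * dc₁ l)) *
                  ∑ m, Yu m m)
            ≤ Λ / lam *
              (1 / 2 * (θ * (ζ0 + ζ1) / ρ * xρ ^ 2 + ρ * ∑ j, xu j ^ 2 + 3 / 2 * ρ / θ * xθ ^ 2) +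
                1 / 2 * ∑ m, (θ * (ζ0 + ζ1) / ρ * Yρ m ^ 2 + ρ * ∑ j, Yu m j ^ 2 +
                  3 / 2 * ρ / θ * Yθ m ^ 2)) := by
  intro K Cb cZ hK hCb _hcZ
  refine ⟨100 * (K + 1) * Cb, by positivity, ?_⟩
  intro lam c₁ ρ θ ζ0 ζ1 ζ2 ηh du du₁ dc₁ dρ dθ xρ xθ xu Yρ Yθ Yu l hlam hc₁ hηh hηcZ hζ0 hζ1 hζ2
    hρ hθ hdu hdρ hdθ
  have hsmall : cZ * ηh ≤ 1 / 8 := by linarith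
  obtain ⟨hR, hdT⟩ := commd_delta_sq hK hc₁ hdρ hdθ
  have key := commd_main_bound K (Cb / lam) c₁ ρ θ ζ0 ζ1 ζ2 (dρ l - 3 * c₁ ^ 2 * dc₁ l)
    (dθ l - 2 * K * c₁ * dc₁ l) xρ xθ _ _ _ _ _ _ (du l) (du₁ l) xu Yρ Yθ Yu hK (by positivity)
    hc₁ (hζ0.trans hsmall) (hζ1.trans hsmall) (hζ2.trans hsmall) hρ hθ hdu hR hdT
    rfl rfl rfl rfl rfl rfl
  simp only [Fin.sum_univ_three]
  exact le_trans (le_of_eq (by ring)) (key.trans_eq (by ring))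

end Summit.AtomisticToContinuum.HydrodynamicLimit.Theorems
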